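import Literature.NumberTheory.Automorphic.LocalUnitaryIntegralLevel            -- ★ `localIntegralLevel`, `isOpen_localIntegralLevel`, `isCompact_localIntegralLevel`, `mem_localIntegralLevel_iff`
import Literature.NumberTheory.Automorphic.AnisotropicUnitaryGroupCompactOfPlace -- ★ `conjLocal_apply_eq_of_smul_eq` (one place above a non-split `v`)
import Literature.NumberTheory.Automorphic.UnitaryGroupSplitPlace                -- ★ `mem_glInt_adicCompletion_iff`
import Literature.NumberTheory.Automorphic.LocalUnitaryGroupUnimodular           -- ★ `conjLocal_det_mul_det` (`σ(det x) · det x = 1` on `U(J)(F_v)`)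
import Literature.NumberTheory.Automorphic.AdelicUnitaryGroupDatum               -- ★ `cmDatum` (`(cmDatum L N H).Local v` IS `↥(«local» L c̄ N H v)`, `rfl`)
import HarnessLib

/-!
# `F0P3bLocalNonsplitCompactCenter` — the FRAME facts of `U(H)(L⁺_v)` at a NON-split place (Ob1 pay-down, leaf (b1))

Cell `hodgecm-mathlib`, F0∕P3 «U3-mult», crux H413 (`stmt-HodgeConjecture-24833`), line «XiLocalPacketUnitary» PAY-DOWN (planner F0P3b-plan (g8),
skeleton `Cruxes/H413/Lines/F0_P3b_XiLocalPacketUnitaryPaydown.lean`, stub `stub_local_nonsplit_compactOpen_center`), pen A-p19 (g17).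

WHAT IS PROVED (theorems only; no `sorry`, no `def`, no instance, no notation).  For a quadratic extension `E ∕ F` of number fields with
conjugation `c ≠ 1`, `J ∈ M_N(E)` with `det J` a unit, and a finite place `v` of `F` that does NOT split in `E` (every `w ∣ v` is fixed by `c`):

* `valued_apply_eq_one_of_coe_eq_scalar` — a SCALAR element `u · 1_N ∈ U(J)(F_v)` (`N ≠ 0`) has `|u_w|_w = 1` at every `w ∣ v`: determinants in the
  unitary relation give `σ(u^N) u^N = 1` (★ `conjLocal_det_mul_det`), `σ = σ_w` componentwise at a non-split place (★ `conjLocal_apply_eq_of_smul_eq`) and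
  `σ_w` preserves `|·|_w` (★ `valued_galAdicCompletionMap`), so `|u_w|_w^{2N} = 1`.
* `mem_localIntegralLevel_of_coe_eq_scalar` — hence every scalar element of `U(J)(F_v)` lies in the compact open level `U(J)(𝒪_v)` (★ `localIntegralLevel`).
* `isCompact_center_local_of_forall_eq_scalar` — **if every central element of `U(J)(F_v)` is scalar, the centre of `U(J)(F_v)` is COMPACT** (closed —
  centralizer of everything in a Hausdorff group — and inside the compact `U(J)(𝒪_v)`).
* `local_nonsplit_compactOpen_center_of_center_le` — CM packaging = the TEXT of `stub_local_nonsplit_compactOpen_center` for `(cmDatum L N H).Local v`,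
  CLOSED modulo the one algebraic input «central ⇒ scalar in `U(H)(L⁺_v)`», carried as the explicit hypothesis `hle` (leaf (b2),
  `Literature/NumberTheory/Automorphic/LocalUnitaryGroupCenter.lean`, to come): a compact open subgroup (★ `isOpen_localIntegralLevel` ∕ ★ `isCompact_localIntegralLevel`)
  and a compact centre.  ED. 2 of the Lines file then reads `stub_local_nonsplit_compactOpen_center hH hHd v hns :=
  local_nonsplit_compactOpen_center_of_center_le L N H hHd v hns (center_le_scalar …)`.

(The centre is `U(1)(L_w ∕ L⁺_v) · 1_N`, the norm-one scalars — compact at a non-split `v`, NOT compact at a split one, where `Z ≅ L_w^×`; the hypothesis `hns`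
is what makes `σ` act place-by-place.) [Rogawski1990 §12.2 p. 173; PlatonovRapinchuk1994 §3.3, §5.1]

HONEST LABEL: HC_CM is proved only modulo the printed citations until rung 0 closes; this leaf discharges nothing by itself.
-/

set_option autoImplicit false
set_option linter.dupNamespace false

noncomputable section

open NumberField IsDedekindDomain
open Literature.NumberTheory.Automorphic Literature.NumberTheory.Automorphic.UnitaryGroup
open scoped Matrix

namespace Summit.HodgeConjecture.HodgeConjecture.Cruxes.H413.F0P3bLocalNonsplitCompactCenter

/-! ## §1 Scalar elements of `U(J)(F_v)` at a non-split place are integral -/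

section Generic

variable {F E : Type} [Field F] [NumberField F] [Field E] [NumberField E] [Algebra F E] [Algebra.IsQuadraticExtension F E]
  (c : E ≃ₐ[F] E) {N : ℕ} (J : Matrix (Fin N) (Fin N) E) (v : HeightOneSpectrum (𝓞 F))

/-- **A scalar element `u · 1_N` of `U(J)(F_v)` has `|u_w|_w = 1` at every place `w ∣ v`, when `v` does not split** (`N ≠ 0`, `det J` a unit):
`σ(det x) det x = 1` with `det x = u^N`, and at a non-split place `(σ y)_w = σ_w(y_w)` with `|σ_w(·)|_w = |·|_w`, so `|u_w|_w^{N+N} = 1`.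
[cite: PlatonovRapinchuk1994, §5.1] [cite: Rogawski1990, §12.2 p. 173] -/
theorem valued_apply_eq_one_of_coe_eq_scalar (hc : c ≠ 1) (hJ : IsUnit J.det) (hN : N ≠ 0)
    (hns : ∀ w : PlacesOver E v, c • w.1 = w.1) {x : «local» E c N J v} {u : (LocalRing E v)ˣ}
    (hx : (x : GL (Fin N) (LocalRing E v)) = Matrix.GeneralLinearGroup.scalar (Fin N) u) (w : PlacesOver E v) :
    Valued.v ((u : LocalRing E v) w) = 1 := by
  have h := conjLocal_det_mul_det c hJ x
  rw [hx, Matrix.GeneralLinearGroup.coe_scalar, Matrix.scalar_apply, Matrix.det_diagonal, Finset.prod_const,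
    Finset.card_univ, Fintype.card_fin] at h
  have hw := congr_fun h w
  rw [Pi.mul_apply, Pi.one_apply, conjLocal_apply_eq_of_smul_eq c hc v w (hns w), Pi.pow_apply] at hw
  have hv := congrArg Valued.v hw
  rw [map_mul, valued_galAdicCompletionMap, map_one, map_pow, ← pow_add] at hv
  have hN2 : N + N ≠ 0 := by omega
  exact le_antisymm ((pow_le_one_iff hN2).1 hv.le) ((one_le_pow_iff hN2).1 hv.ge)

omit [NumberField F] [Algebra.IsQuadraticExtension F E] in
/-- Entries of the `w`-component of a scalar matrix `u · 1_N ∈ GL_N(E_v)` with `|u_w|_w ≤ 1` are `w`-integral. [cite: PlatonovRapinchuk1994, §5.1] -/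
theorem apply_mem_adicCompletionIntegers_of_eq_scalar {g : GL (Fin N) (LocalRing E v)} {u : (LocalRing E v)ˣ}
    (hg : g = Matrix.GeneralLinearGroup.scalar (Fin N) u) (w : PlacesOver E v) (hu : Valued.v ((u : LocalRing E v) w) ≤ 1) (i j : Fin N) :
    ((localGLPiEquiv E N v g w : GL (Fin N) (w.1.adicCompletion E)) : Matrix (Fin N) (Fin N) (w.1.adicCompletion E)) i j ∈
      w.1.adicCompletionIntegers E := by
  rw [GLn.coe_piEquiv_apply, Matrix.map_apply, hg, Matrix.GeneralLinearGroup.coe_scalar, Matrix.scalar_apply, Matrix.diagonal_apply,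
    HeightOneSpectrum.mem_adicCompletionIntegers, Pi.evalRingHom_apply]
  split_ifs
  · exact hu
  · rw [Pi.zero_apply, map_zero]
    exact zero_le

/-- **Scalar elements of `U(J)(F_v)` lie in the level `U(J)(𝒪_v)`** at a non-split `v` (`det J` a unit): by `valued_apply_eq_one_of_coe_eq_scalar` for `x` and
`x⁻¹ = u⁻¹ · 1_N`, all entries of `x_w` and `x_w⁻¹` are `w`-integral (★ `mem_localIntegralLevel_iff`, ★ `mem_glInt_adicCompletion_iff`).
[cite: PlatonovRapinchuk1994, §5.1] -/
theorem mem_localIntegralLevel_of_coe_eq_scalar (hc : c ≠ 1) (hJ : IsUnit J.det) (hns : ∀ w : PlacesOver E v, c • w.1 = w.1)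
    {x : «local» E c N J v} {u : (LocalRing E v)ˣ} (hx : (x : GL (Fin N) (LocalRing E v)) = Matrix.GeneralLinearGroup.scalar (Fin N) u) :
    x ∈ localIntegralLevel c N J v := by
  rw [mem_localIntegralLevel_iff]
  intro w
  rw [mem_glInt_adicCompletion_iff]
  have hx' : ((x⁻¹ : «local» E c N J v) : GL (Fin N) (LocalRing E v)) = Matrix.GeneralLinearGroup.scalar (Fin N) u⁻¹ := by
    rw [Subgroup.coe_inv, hx, map_inv]
  have hinv : (localGLPiEquiv E N v (x : GL (Fin N) (LocalRing E v)) w)⁻¹ =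
      localGLPiEquiv E N v ((x⁻¹ : «local» E c N J v) : GL (Fin N) (LocalRing E v)) w := by
    rw [Subgroup.coe_inv, map_inv, Pi.inv_apply]
  rw [hinv]
  exact ⟨fun i j => apply_mem_adicCompletionIntegers_of_eq_scalar v hx w
      (valued_apply_eq_one_of_coe_eq_scalar c J v hc hJ i.pos.ne' hns hx w).le i j,
    fun i j => apply_mem_adicCompletionIntegers_of_eq_scalar v hx' w
      (valued_apply_eq_one_of_coe_eq_scalar c J v hc hJ i.pos.ne' hns hx' w).le i j⟩

omit [Algebra.IsQuadraticExtension F E] in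
/-- The centre of `U(J)(F_v)` is closed (centralizer of everything in a Hausdorff topological group). [folklore] -/
theorem isClosed_center_local : IsClosed (Subgroup.center («local» E c N J v) : Set («local» E c N J v)) := by
  rw [Subgroup.coe_center, ← Set.centralizer_univ]
  exact Set.isClosed_centralizer _

/-- **The centre of `U(J)(F_v)` is COMPACT at a non-split place, as soon as every central element is scalar** (`det J` a unit): it is closed and
contained in the compact level `U(J)(𝒪_v)` (`mem_localIntegralLevel_of_coe_eq_scalar`, ★ `isCompact_localIntegralLevel`).  The algebraic input «central ⇒
scalar» (Schur for the absolutely irreducible standard representation of `U_N`) is the hypothesis `hle`.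
[cite: PlatonovRapinchuk1994, §3.3; §5.1] [cite: Rogawski1990, §12.2 p. 173] -/
theorem isCompact_center_local_of_forall_eq_scalar (hc : c ≠ 1) (hJ : IsUnit J.det) (hns : ∀ w : PlacesOver E v, c • w.1 = w.1)
    (hle : ∀ z ∈ Subgroup.center («local» E c N J v),
      ∃ u : (LocalRing E v)ˣ, (z : GL (Fin N) (LocalRing E v)) = Matrix.GeneralLinearGroup.scalar (Fin N) u) :
    IsCompact (Subgroup.center («local» E c N J v) : Set («local» E c N J v)) := by
  refine (isCompact_localIntegralLevel c N J v).of_isClosed_subset (isClosed_center_local c J v) fun z hz => ?_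
  obtain ⟨u, hu⟩ := hle z hz
  exact mem_localIntegralLevel_of_coe_eq_scalar c J v hc hJ hns hu

omit [Algebra.IsQuadraticExtension F E] in
/-- The compact-open half alone: `U(J)(𝒪_v) ≤ U(J)(F_v)` is a compact open subgroup (any `v`). [cite: PlatonovRapinchuk1994, §5.1] -/
theorem exists_compactOpen_subgroup_local :
    ∃ K₀ : Subgroup («local» E c N J v), IsOpen (K₀ : Set («local» E c N J v)) ∧ IsCompact (K₀ : Set («local» E c N J v)) :=
  ⟨localIntegralLevel c N J v, isOpen_localIntegralLevel c N J v, isCompact_localIntegralLevel c N J v⟩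

end Generic

/-! ## §2 CM packaging: the text of `stub_local_nonsplit_compactOpen_center`, closed modulo «central ⇒ scalar» -/

section CM

variable (L : Type) [Field L] [NumberField L] [IsCMField L] (N : ℕ) (H : Matrix (Fin N) (Fin N) L)

/-- **FRAME FACTS at a non-split place (Ob1 stub text, modulo «central ⇒ scalar»)**: for a CM field `L`, `H ∈ M_N(L)` with `det H` a unit, and a finite
place `v` of `L⁺` all of whose extensions `w ∣ v` to `L` are fixed by complex conjugation, IF every central element of `U(H)(L⁺_v) = (cmDatum L N H).Local v`
is a scalar `u · 1_N` (`u ∈ (L ⊗ L⁺_v)^×`), THEN `U(H)(L⁺_v)` has a compact open subgroup and compact centre.  (The hermitian symmetry of `H` is not needed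
for this half, so it is not an argument.) [cite: Rogawski1990, §12.2 p. 173] [cite: PlatonovRapinchuk1994, §3.3; §5.1] -/
theorem local_nonsplit_compactOpen_center_of_center_le (hHd : IsUnit H.det) (v : HeightOneSpectrum (𝓞 ↥(maximalRealSubfield L)))
    (hns : ∀ w : PlacesOver L v, IsCMField.complexConj L • w.1 = w.1)
    (hle : ∀ z ∈ Subgroup.center («local» L (IsCMField.complexConj L) N H v),
      ∃ u : (LocalRing L v)ˣ, (z : GL (Fin N) (LocalRing L v)) = Matrix.GeneralLinearGroup.scalar (Fin N) u) :
    (∃ K₀ : Subgroup ((cmDatum L N H).Local v),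
        IsOpen (K₀ : Set ((cmDatum L N H).Local v)) ∧ IsCompact (K₀ : Set ((cmDatum L N H).Local v))) ∧
      IsCompact ((Subgroup.center ((cmDatum L N H).Local v) : Subgroup ((cmDatum L N H).Local v)) : Set ((cmDatum L N H).Local v)) :=
  ⟨exists_compactOpen_subgroup_local (IsCMField.complexConj L) H v,
    isCompact_center_local_of_forall_eq_scalar (IsCMField.complexConj L) H v (IsCMField.complexConj_ne_one L) hHd hns hle⟩

end CM

end Summit.HodgeConjecture.HodgeConjecture.Cruxes.H413.F0P3bLocalNonsplitCompactCenter

end
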